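import Literature.Geometry.Symplectic.SphereCROperatorBanach
import Literature.Geometry.Symplectic.SphereCROperatorVariation
import HarnessLib

/-!
# The derivative of the chart Cauchy–Riemann operators at a small solution, chartwise

Layer B7b of the analytic core of the Hofer–Lizan–Sikorav local foliation theorem (Wendl 2018,
Thm. 2.46; lead of crux `WitnessCharge`, summit `SmoothPoincare4`), generalising
`SphereCROperatorDerivativeZero.lean` from the zero section to an arbitrary smooth small
SOLUTION. For chart data `𝒥 : SphereACData`:

* `fderiv_jetOp₀_apply_of_crExpr_eq_zero`: at the 1-jet `(z, ξ₁ z, Dξ₁ z, f₁ z, Df₁ z)` of `C²`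
  data with `‖ξ₁ z‖ < 2` and `crExpr J₀ (vmap₀ ξ₁ f₁) z = 0`, the Fréchet derivative of the jet
  operator `jetOp₀` in the direction of the 1-jet `(0, δξ z, Dδξ z, δf z, Dδf z)` is the
  first-variation formula `hasDerivAt_crOp₀_variation` (the directional derivative along the
  affine line of jets `s ↦ q₁ + s • v` is, for `s` near `0`, the curve
  `s ↦ crOp₀ (ξ₁ + s δξ) (f₁ + s δf) z`, by `crOp₀_eq_jetOp₀`);
* `fderiv_jetOp₁_apply_of_crExpr_eq_zero`: the same in chart `1` (the swapped data);
* `dout₀_apply_of_sol`, `dout₁_apply_of_sol`: hence, for `k ≥ 1` and a SMALL `y₁ : SecPair k r`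
  whose chart representatives solve the Cauchy–Riemann equation on the discs of radius `3`,
  the derivative `dout₀ y₁ δ z` of the Banach map `out₀` of `SphereCROperatorBanach.lean` is
  `ρ z •` the first-variation formula for the representatives
  `ξ₁ = sec₀ (-w²) y₁.1`, `f₁ = sec₀ 1 y₁.2`, `δξ = sec₀ (-w²) δ.1`, `δf = sec₀ 1 δ.2`
  (and likewise in chart `1`), for `‖z‖ < 3` and — both sides vanishing off that disc — for all
  `z` (`dout₀_apply_of_sol'`, `dout₁_apply_of_sol'`).

## References

* C. Wendl, *Holomorphic Curves in Low Dimensions*, LNM 2216 (2018), §2.1, §2.3, Thm. 2.46.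
  [Wendl2018]
-/

noncomputable section

open Set Filter Metric Function Complex
open scoped Topology NNReal ContDiff
open Literature.Analysis.FunctionSpaces Literature.Analysis.Complex.RiemannSphere
open Literature.Analysis.Complex.ProjectiveLineExpChart Literature.Geometry.Symplectic.CRExpression

namespace Literature.Geometry.Symplectic

namespace SphereCR

namespace SphereACData

variable (𝒥 : SphereACData)

/-! ### The derivative of the jet operator at the jet of a solution -/

section Axis

variable {ξ₁ f₁ δξ δf : ℂ → ℂ}

/-- **The jet operator along the line of jets of `s ↦ (ξ₁ + s δξ, f₁ + s δf)` at `z`** has, at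
`s = 0`, the derivative given by the first-variation formula, provided `‖ξ₁ z‖ < 2` (so the
exponential chart is nondegenerate) and `crExpr J₀ (vmap₀ ξ₁ f₁) z = 0`: for `s` near `0` the
line of jets is the 1-jet of `(ξ₁ + s δξ, f₁ + s δf)` and the jet operator there is
`crOp₀ (ξ₁ + s δξ) (f₁ + s δf) z` (`crOp₀_eq_jetOp₀`). [cite: Wendl2018, Thm. 2.46] -/
theorem hasDerivAt_jetOp₀_line_of_crExpr_eq_zero (hξ₁ : ContDiff ℝ 2 ξ₁) (hf₁ : ContDiff ℝ 2 f₁)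
    (hδξ : ContDiff ℝ 2 δξ) (hδf : ContDiff ℝ 2 δf) {z : ℂ} (hc : ‖ξ₁ z‖ < 2)
    (hsol : crExpr 𝒥.J₀ (𝒥.vmap₀ ξ₁ f₁) z = 0) :
    HasDerivAt (fun s : ℝ => 𝒥.jetOp₀
        (z, ξ₁ z + s • δξ z, fderiv ℝ ξ₁ z + s • fderiv ℝ δξ z, f₁ z + s • δf z,
          fderiv ℝ f₁ z + s • fderiv ℝ δf z))
      (𝒥.Phi₀ ξ₁ f₁ z
        (fderiv ℝ (𝒥.dvmap₀ ξ₁ δξ δf) z 1 +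
          𝒥.J₀ (𝒥.vmap₀ ξ₁ f₁ z) (fderiv ℝ (𝒥.dvmap₀ ξ₁ δξ δf) z I) +
          (fderiv ℝ 𝒥.J₀ (𝒥.vmap₀ ξ₁ f₁ z) (𝒥.dvmap₀ ξ₁ δξ δf z))
            (fderiv ℝ (𝒥.vmap₀ ξ₁ f₁) z I))) 0 := by
  have hden0 : den z (ξ₁ z) ≠ 0 := den_ne_zero_of_norm_lt_two hc
  have h := 𝒥.hasDerivAt_crOp₀_variation hξ₁ hf₁ hδξ hδf hden0 hsol
  refine h.congr_of_eventuallyEq ?_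
  -- for `s` near `0` the chart is nondegenerate at `(ξ₁ + s δξ) z` and the operator is in jet form
  have hden : ∀ᶠ s : ℝ in 𝓝 0, den z ((ξ₁ + s • δξ) z) ≠ 0 := by
    have hcont : Continuous fun s : ℝ => den z ((ξ₁ + s • δξ) z) := by
      have : (fun s : ℝ => den z ((ξ₁ + s • δξ) z)) =
          fun s : ℝ => den z (ξ₁ z + (s : ℂ) * δξ z) := by
        funext s; simp [Complex.real_smul]
      rw [this]
      unfold den
      fun_prop
    exact hcont.continuousAt.eventually_ne (by simpa using hden0)
  filter_upwards [hden] with s hs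
  have hξ₁d : DifferentiableAt ℝ ξ₁ z := (hξ₁.differentiable (by simp)).differentiableAt
  have hf₁d : DifferentiableAt ℝ f₁ z := (hf₁.differentiable (by simp)).differentiableAt
  have hδξd : DifferentiableAt ℝ δξ z := (hδξ.differentiable (by simp)).differentiableAt
  have hδfd : DifferentiableAt ℝ δf z := (hδf.differentiable (by simp)).differentiableAt
  have hdξ : DifferentiableAt ℝ (ξ₁ + s • δξ) z := hξ₁d.add (hδξd.const_smul s)
  have hdf : DifferentiableAt ℝ (f₁ + s • δf) z := hf₁d.add (hδfd.const_smul s)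
  rw [𝒥.crOp₀_eq_jetOp₀ hdξ hdf hs]
  have e3 : fderiv ℝ (ξ₁ + s • δξ) z = fderiv ℝ ξ₁ z + s • fderiv ℝ δξ z := by
    rw [fderiv_add hξ₁d (hδξd.const_smul s), fderiv_const_smul hδξd s]
  have e4 : fderiv ℝ (f₁ + s • δf) z = fderiv ℝ f₁ z + s • fderiv ℝ δf z := by
    rw [fderiv_add hf₁d (hδfd.const_smul s), fderiv_const_smul hδfd s]
  rw [e3, e4]
  rfl

/-- **The Fréchet derivative of the jet operator at the jet of a solution.** For `C²` data
`ξ₁, f₁, δξ, δf` with `‖ξ₁ z‖ < 2` and `crExpr J₀ (vmap₀ ξ₁ f₁) z = 0`, the Fréchet derivative of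
`jetOp₀` at the 1-jet `(z, ξ₁ z, Dξ₁ z, f₁ z, Df₁ z)` in the direction of the 1-jet
`(0, δξ z, Dδξ z, δf z, Dδf z)` is the first variation of `crOp₀`:
`Φ₀ z (D(dvmap₀) z 1 + J₀ (vmap₀ z) (D(dvmap₀) z I) + (DJ₀ (vmap₀ z) (dvmap₀ z)) (D(vmap₀) z I))`.
[cite: Wendl2018, Thm. 2.46] -/
theorem fderiv_jetOp₀_apply_of_crExpr_eq_zero (hξ₁ : ContDiff ℝ 2 ξ₁) (hf₁ : ContDiff ℝ 2 f₁)
    (hδξ : ContDiff ℝ 2 δξ) (hδf : ContDiff ℝ 2 δf) {z : ℂ} (hc : ‖ξ₁ z‖ < 2)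
    (hsol : crExpr 𝒥.J₀ (𝒥.vmap₀ ξ₁ f₁) z = 0) :
    fderiv ℝ 𝒥.jetOp₀ (z, ξ₁ z, fderiv ℝ ξ₁ z, f₁ z, fderiv ℝ f₁ z)
        ((0 : ℂ), δξ z, fderiv ℝ δξ z, δf z, fderiv ℝ δf z) =
      𝒥.Phi₀ ξ₁ f₁ z
        (fderiv ℝ (𝒥.dvmap₀ ξ₁ δξ δf) z 1 +
          𝒥.J₀ (𝒥.vmap₀ ξ₁ f₁ z) (fderiv ℝ (𝒥.dvmap₀ ξ₁ δξ δf) z I) +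
          (fderiv ℝ 𝒥.J₀ (𝒥.vmap₀ ξ₁ f₁ z) (𝒥.dvmap₀ ξ₁ δξ δf z))
            (fderiv ℝ (𝒥.vmap₀ ξ₁ f₁) z I)) := by
  set q₁ : Jet := ((z : ℂ), ξ₁ z, fderiv ℝ ξ₁ z, f₁ z, fderiv ℝ f₁ z) with hq₁
  set v : Jet := ((0 : ℂ), δξ z, fderiv ℝ δξ z, δf z, fderiv ℝ δf z) with hv
  have hd : DifferentiableAt ℝ 𝒥.jetOp₀ q₁ :=
    (𝒥.contDiffAt_jetOp₀ (q := q₁) hc).differentiableAt (by simp)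
  have hline : HasDerivAt (fun s : ℝ => 𝒥.jetOp₀ (q₁ + s • v)) (fderiv ℝ 𝒥.jetOp₀ q₁ v) 0 :=
    hd.hasFDerivAt.comp_hasDerivAt_of_eq 0 (hasDerivAt_const_add_smul q₁ v 0)
      (by rw [zero_smul ℝ v, add_zero])
  have heq : (fun s : ℝ => 𝒥.jetOp₀ (q₁ + s • v)) =
      fun s : ℝ => 𝒥.jetOp₀ (z, ξ₁ z + s • δξ z, fderiv ℝ ξ₁ z + s • fderiv ℝ δξ z,
        f₁ z + s • δf z, fderiv ℝ f₁ z + s • fderiv ℝ δf z) := by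
    funext s
    simp [hq₁, hv]
  rw [heq] at hline
  exact hline.unique (𝒥.hasDerivAt_jetOp₀_line_of_crExpr_eq_zero hξ₁ hf₁ hδξ hδf hc hsol)

/-- **Chart `1`**: the Fréchet derivative of `jetOp₁` at the jet of a solution of
`crExpr J₁ (vmap₁ ξ₁ f₁) w = 0` with `‖ξ₁ w‖ < 2`, in a jet direction, is the first variation of
`crOp₁` — the chart-`0` statement for the swapped data `𝒥.swap`. [cite: Wendl2018, Thm. 2.46] -/
theorem fderiv_jetOp₁_apply_of_crExpr_eq_zero (hξ₁ : ContDiff ℝ 2 ξ₁) (hf₁ : ContDiff ℝ 2 f₁)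
    (hδξ : ContDiff ℝ 2 δξ) (hδf : ContDiff ℝ 2 δf) {w : ℂ} (hc : ‖ξ₁ w‖ < 2)
    (hsol : crExpr 𝒥.J₁ (𝒥.vmap₁ ξ₁ f₁) w = 0) :
    fderiv ℝ 𝒥.jetOp₁ (w, ξ₁ w, fderiv ℝ ξ₁ w, f₁ w, fderiv ℝ f₁ w)
        ((0 : ℂ), δξ w, fderiv ℝ δξ w, δf w, fderiv ℝ δf w) =
      𝒥.swap.Phi₀ ξ₁ f₁ w
        (fderiv ℝ (𝒥.swap.dvmap₀ ξ₁ δξ δf) w 1 +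
          𝒥.swap.J₀ (𝒥.swap.vmap₀ ξ₁ f₁ w) (fderiv ℝ (𝒥.swap.dvmap₀ ξ₁ δξ δf) w I) +
          (fderiv ℝ 𝒥.swap.J₀ (𝒥.swap.vmap₀ ξ₁ f₁ w) (𝒥.swap.dvmap₀ ξ₁ δξ δf w))
            (fderiv ℝ (𝒥.swap.vmap₀ ξ₁ f₁) w I)) :=
  𝒥.swap.fderiv_jetOp₀_apply_of_crExpr_eq_zero hξ₁ hf₁ hδξ hδf hc hsol

end Axis

/-! ### The derivative of the Banach maps at a small solution, chartwise -/

section Banach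

variable {r : ℝ≥0} (hr : r ≤ 1) (k : ℕ)

-- The next six lemmas are local copies of lemmas of `SphereCROperatorDerivativeZero.lean`
-- (adapted verbatim), kept private so that this module does not depend on that one.

/-- The linear part of the `z`-jet map on the disc `‖z‖ < 4`: the 1-jet of the representatives
with first slot `0`. [folklore] -/
private theorem jets₀CLM_apply_of_norm_lt_aux (δ : SecPair k r) {z : ℂ} (hz : ‖z‖ < 4) :
    jets₀CLM hr k δ z = ((0 : ℂ), sec₀ (fun w : ℂ => -w ^ 2) δ.1.1 z,
      fderiv ℝ (sec₀ (fun w : ℂ => -w ^ 2) δ.1.1) z, sec₀ (1 : ℂ → ℂ) δ.2.1 z,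
      fderiv ℝ (sec₀ (1 : ℂ → ℂ) δ.2.1) z) := by
  -- adapted from `SphereCROperatorDerivativeZero.jets₀CLM_apply_of_norm_lt`
  have h := congrArg (fun u : ContDiffHolderFunction ℂ Jet k r => u z) (jets₀_sub hr k δ 0)
  simp only [sub_zero, ContDiffHolderFunction.coe_sub, Pi.sub_apply] at h
  rw [← h, jets₀_apply_of_norm_lt hr k δ hz, jets₀_zero_apply_of_norm_lt hr k hz]
  ext <;> simp

/-- The linear part of the `w`-jet map on the disc `‖w‖ < 4`. [folklore] -/
private theorem jets₁CLM_apply_of_norm_lt_aux (δ : SecPair k r) {w : ℂ} (hw : ‖w‖ < 4) :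
    jets₁CLM hr k δ w = ((0 : ℂ), sec₁ (fun w : ℂ => -w ^ 2) δ.1.1 w,
      fderiv ℝ (sec₁ (fun w : ℂ => -w ^ 2) δ.1.1) w, sec₁ (1 : ℂ → ℂ) δ.2.1 w,
      fderiv ℝ (sec₁ (1 : ℂ → ℂ) δ.2.1) w) := by
  -- adapted from `SphereCROperatorDerivativeZero.jets₁CLM_apply_of_norm_lt`
  have h := congrArg (fun u : ContDiffHolderFunction ℂ Jet k r => u w) (jets₁_sub hr k δ 0)
  simp only [sub_zero, ContDiffHolderFunction.coe_sub, Pi.sub_apply] at h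
  rw [← h, jets₁_apply_of_norm_lt hr k δ hw, jets₁_zero_apply_of_norm_lt hr k hw]
  ext <;> simp

variable {hr k}

/-- Chart-`0` tangent representatives of level `k + 1 ≥ 2` are `C²`. [folklore] -/
private theorem contDiff_two_sec₀_T_aux (hk : 1 ≤ k) (y : SecPair k r) :
    ContDiff ℝ 2 (sec₀ (fun w : ℂ => -w ^ 2) y.1.1) :=
  (contDiff_sec₀ y.1.2 neg_sq_clutch_ne_zero contDiffOn_neg_sq_clutch).of_le
    (by exact_mod_cast Nat.succ_le_succ hk)

/-- Chart-`0` normal representatives of level `k + 1 ≥ 2` are `C²`. [folklore] -/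
private theorem contDiff_two_sec₀_N_aux (hk : 1 ≤ k) (y : SecPair k r) :
    ContDiff ℝ 2 (sec₀ (1 : ℂ → ℂ) y.2.1) :=
  (contDiff_sec₀ y.2.2 one_clutch_ne_zero contDiffOn_one_clutch).of_le
    (by exact_mod_cast Nat.succ_le_succ hk)

/-- Chart-`1` tangent representatives of level `k + 1 ≥ 2` are `C²`. [folklore] -/
private theorem contDiff_two_sec₁_T_aux (hk : 1 ≤ k) (y : SecPair k r) :
    ContDiff ℝ 2 (sec₁ (fun w : ℂ => -w ^ 2) y.1.1) :=
  (contDiff_sec₁ y.1.2 contDiffOn_neg_sq_clutch).of_le (by exact_mod_cast Nat.succ_le_succ hk)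

/-- Chart-`1` normal representatives of level `k + 1 ≥ 2` are `C²`. [folklore] -/
private theorem contDiff_two_sec₁_N_aux (hk : 1 ≤ k) (y : SecPair k r) :
    ContDiff ℝ 2 (sec₁ (1 : ℂ → ℂ) y.2.1) :=
  (contDiff_sec₁ y.2.2 contDiffOn_one_clutch).of_le (by exact_mod_cast Nat.succ_le_succ hk)

/-- **Chart `0`: the derivative of `out₀` at a small solution.** For `k ≥ 1`, a small
`y₁ = (ξ, f) : SecPair k r` whose chart-`0` representatives `ξ₁ = sec₀ (-w²) ξ`, `f₁ = sec₀ 1 f`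
solve `crExpr J₀ (vmap₀ ξ₁ f₁) = 0` on the disc `‖z‖ < 3`, and `‖z‖ < 3`:
`dout₀ y₁ δ z = ρ z • Φ₀ z (D(dvmap₀) z 1 + J₀ (vmap₀ z) (D(dvmap₀) z I) + (DJ₀ (vmap₀ z) X) Y)`
with `X = dvmap₀ z`, `Y = D(vmap₀) z I`, `δξ = sec₀ (-w²) δ.1`, `δf = sec₀ 1 δ.2` (`dout₀_apply`,
`jets₀_apply_of_norm_lt`, `fderiv_phiCut₀` since `|ξ₁ z| < 1/4 < 1`, `jets₀CLM_apply_of_norm_lt`,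
and `fderiv_jetOp₀_apply_of_crExpr_eq_zero`). [cite: Wendl2018, Thm. 2.46] -/
theorem dout₀_apply_of_sol (hk : 1 ≤ k) {y₁ : SecPair k r} (hy : Small hr k y₁)
    (hsol₀ : ∀ z : ℂ, ‖z‖ < 3 → crExpr 𝒥.J₀ (𝒥.vmap₀ (sec₀ (fun w : ℂ => -w ^ 2) y₁.1.1)
      (sec₀ (1 : ℂ → ℂ) y₁.2.1)) z = 0)
    (δ : SecPair k r) {z : ℂ} (hz : ‖z‖ < 3) :
    𝒥.dout₀ hr k y₁ δ z = rhoCut z •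
      𝒥.Phi₀ (sec₀ (fun w : ℂ => -w ^ 2) y₁.1.1) (sec₀ (1 : ℂ → ℂ) y₁.2.1) z
        (fderiv ℝ (𝒥.dvmap₀ (sec₀ (fun w : ℂ => -w ^ 2) y₁.1.1)
            (sec₀ (fun w : ℂ => -w ^ 2) δ.1.1) (sec₀ (1 : ℂ → ℂ) δ.2.1)) z 1 +
          𝒥.J₀ (𝒥.vmap₀ (sec₀ (fun w : ℂ => -w ^ 2) y₁.1.1) (sec₀ (1 : ℂ → ℂ) y₁.2.1) z)
            (fderiv ℝ (𝒥.dvmap₀ (sec₀ (fun w : ℂ => -w ^ 2) y₁.1.1)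
              (sec₀ (fun w : ℂ => -w ^ 2) δ.1.1) (sec₀ (1 : ℂ → ℂ) δ.2.1)) z I) +
          (fderiv ℝ 𝒥.J₀ (𝒥.vmap₀ (sec₀ (fun w : ℂ => -w ^ 2) y₁.1.1) (sec₀ (1 : ℂ → ℂ) y₁.2.1) z)
              (𝒥.dvmap₀ (sec₀ (fun w : ℂ => -w ^ 2) y₁.1.1) (sec₀ (fun w : ℂ => -w ^ 2) δ.1.1)
                (sec₀ (1 : ℂ → ℂ) δ.2.1) z))
            (fderiv ℝ (𝒥.vmap₀ (sec₀ (fun w : ℂ => -w ^ 2) y₁.1.1) (sec₀ (1 : ℂ → ℂ) y₁.2.1))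
              z I)) := by
  have hz4 : ‖z‖ < 4 := hz.trans (by norm_num)
  have hc : ‖sec₀ (fun w : ℂ => -w ^ 2) y₁.1.1 z‖ < 1 :=
    (norm_sec₀_lt_of_small hy hz4.le).trans (by norm_num)
  rw [dout₀_apply, jets₀_apply_of_norm_lt hr k y₁ hz4, 𝒥.fderiv_phiCut₀ (by exact hc),
    jets₀CLM_apply_of_norm_lt_aux hr k δ hz4,
    𝒥.fderiv_jetOp₀_apply_of_crExpr_eq_zero (contDiff_two_sec₀_T_aux hk y₁)
      (contDiff_two_sec₀_N_aux hk y₁) (contDiff_two_sec₀_T_aux hk δ) (contDiff_two_sec₀_N_aux hk δ)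
      (hc.trans (by norm_num)) (hsol₀ z hz)]

/-- **Chart `0`, all `z`**: the formula of `dout₀_apply_of_sol` holds at every `z ∈ ℂ` (for
`3 ≤ ‖z‖` both sides vanish, `ρ z = 0`). [cite: Wendl2018, Thm. 2.46] -/
theorem dout₀_apply_of_sol' (hk : 1 ≤ k) {y₁ : SecPair k r} (hy : Small hr k y₁)
    (hsol₀ : ∀ z : ℂ, ‖z‖ < 3 → crExpr 𝒥.J₀ (𝒥.vmap₀ (sec₀ (fun w : ℂ => -w ^ 2) y₁.1.1)
      (sec₀ (1 : ℂ → ℂ) y₁.2.1)) z = 0)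
    (δ : SecPair k r) (z : ℂ) :
    𝒥.dout₀ hr k y₁ δ z = rhoCut z •
      𝒥.Phi₀ (sec₀ (fun w : ℂ => -w ^ 2) y₁.1.1) (sec₀ (1 : ℂ → ℂ) y₁.2.1) z
        (fderiv ℝ (𝒥.dvmap₀ (sec₀ (fun w : ℂ => -w ^ 2) y₁.1.1)
            (sec₀ (fun w : ℂ => -w ^ 2) δ.1.1) (sec₀ (1 : ℂ → ℂ) δ.2.1)) z 1 +
          𝒥.J₀ (𝒥.vmap₀ (sec₀ (fun w : ℂ => -w ^ 2) y₁.1.1) (sec₀ (1 : ℂ → ℂ) y₁.2.1) z)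
            (fderiv ℝ (𝒥.dvmap₀ (sec₀ (fun w : ℂ => -w ^ 2) y₁.1.1)
              (sec₀ (fun w : ℂ => -w ^ 2) δ.1.1) (sec₀ (1 : ℂ → ℂ) δ.2.1)) z I) +
          (fderiv ℝ 𝒥.J₀ (𝒥.vmap₀ (sec₀ (fun w : ℂ => -w ^ 2) y₁.1.1) (sec₀ (1 : ℂ → ℂ) y₁.2.1) z)
              (𝒥.dvmap₀ (sec₀ (fun w : ℂ => -w ^ 2) y₁.1.1) (sec₀ (fun w : ℂ => -w ^ 2) δ.1.1)
                (sec₀ (1 : ℂ → ℂ) δ.2.1) z))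
            (fderiv ℝ (𝒥.vmap₀ (sec₀ (fun w : ℂ => -w ^ 2) y₁.1.1) (sec₀ (1 : ℂ → ℂ) y₁.2.1))
              z I)) := by
  by_cases hz : ‖z‖ < 3
  · exact 𝒥.dout₀_apply_of_sol hk hy hsol₀ δ hz
  · rw [dout₀_apply, rhoCut_eq_zero (not_lt.1 hz), zero_smul, zero_smul]

/-- **Chart `1`: the derivative of `out₁` at a small solution.** For `k ≥ 1`, a small
`y₁ : SecPair k r` whose chart-`1` representatives `ξ₁ = sec₁ (-w²) y₁.1`, `f₁ = sec₁ 1 y₁.2`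
solve `crExpr J₁ (vmap₁ ξ₁ f₁) = 0` on the disc `‖w‖ < 3`, and `‖w‖ < 3`: `dout₁ y₁ δ w` is
`ρ w •` the first-variation formula of the swapped data `𝒥.swap` for the chart-`1`
representatives. [cite: Wendl2018, Thm. 2.46] -/
theorem dout₁_apply_of_sol (hk : 1 ≤ k) {y₁ : SecPair k r} (hy : Small hr k y₁)
    (hsol₁ : ∀ w : ℂ, ‖w‖ < 3 → crExpr 𝒥.J₁ (𝒥.vmap₁ (sec₁ (fun w : ℂ => -w ^ 2) y₁.1.1)
      (sec₁ (1 : ℂ → ℂ) y₁.2.1)) w = 0)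
    (δ : SecPair k r) {w : ℂ} (hw : ‖w‖ < 3) :
    𝒥.dout₁ hr k y₁ δ w = rhoCut w •
      𝒥.swap.Phi₀ (sec₁ (fun w : ℂ => -w ^ 2) y₁.1.1) (sec₁ (1 : ℂ → ℂ) y₁.2.1) w
        (fderiv ℝ (𝒥.swap.dvmap₀ (sec₁ (fun w : ℂ => -w ^ 2) y₁.1.1)
            (sec₁ (fun w : ℂ => -w ^ 2) δ.1.1) (sec₁ (1 : ℂ → ℂ) δ.2.1)) w 1 +
          𝒥.swap.J₀ (𝒥.swap.vmap₀ (sec₁ (fun w : ℂ => -w ^ 2) y₁.1.1) (sec₁ (1 : ℂ → ℂ) y₁.2.1) w)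
            (fderiv ℝ (𝒥.swap.dvmap₀ (sec₁ (fun w : ℂ => -w ^ 2) y₁.1.1)
              (sec₁ (fun w : ℂ => -w ^ 2) δ.1.1) (sec₁ (1 : ℂ → ℂ) δ.2.1)) w I) +
          (fderiv ℝ 𝒥.swap.J₀
              (𝒥.swap.vmap₀ (sec₁ (fun w : ℂ => -w ^ 2) y₁.1.1) (sec₁ (1 : ℂ → ℂ) y₁.2.1) w)
              (𝒥.swap.dvmap₀ (sec₁ (fun w : ℂ => -w ^ 2) y₁.1.1)
                (sec₁ (fun w : ℂ => -w ^ 2) δ.1.1) (sec₁ (1 : ℂ → ℂ) δ.2.1) w))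
            (fderiv ℝ (𝒥.swap.vmap₀ (sec₁ (fun w : ℂ => -w ^ 2) y₁.1.1)
              (sec₁ (1 : ℂ → ℂ) y₁.2.1)) w I)) := by
  have hw4 : ‖w‖ < 4 := hw.trans (by norm_num)
  have hc : ‖sec₁ (fun w : ℂ => -w ^ 2) y₁.1.1 w‖ < 1 :=
    (norm_sec₁_lt_of_small hy hw4.le).trans (by norm_num)
  rw [dout₁_apply, jets₁_apply_of_norm_lt hr k y₁ hw4, 𝒥.fderiv_phiCut₁ (by exact hc),
    jets₁CLM_apply_of_norm_lt_aux hr k δ hw4,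
    𝒥.fderiv_jetOp₁_apply_of_crExpr_eq_zero (contDiff_two_sec₁_T_aux hk y₁)
      (contDiff_two_sec₁_N_aux hk y₁) (contDiff_two_sec₁_T_aux hk δ) (contDiff_two_sec₁_N_aux hk δ)
      (hc.trans (by norm_num)) (hsol₁ w hw)]

/-- **Chart `1`, all `w`**: the formula of `dout₁_apply_of_sol` holds at every `w ∈ ℂ`.
[cite: Wendl2018, Thm. 2.46] -/
theorem dout₁_apply_of_sol' (hk : 1 ≤ k) {y₁ : SecPair k r} (hy : Small hr k y₁)
    (hsol₁ : ∀ w : ℂ, ‖w‖ < 3 → crExpr 𝒥.J₁ (𝒥.vmap₁ (sec₁ (fun w : ℂ => -w ^ 2) y₁.1.1)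
      (sec₁ (1 : ℂ → ℂ) y₁.2.1)) w = 0)
    (δ : SecPair k r) (w : ℂ) :
    𝒥.dout₁ hr k y₁ δ w = rhoCut w •
      𝒥.swap.Phi₀ (sec₁ (fun w : ℂ => -w ^ 2) y₁.1.1) (sec₁ (1 : ℂ → ℂ) y₁.2.1) w
        (fderiv ℝ (𝒥.swap.dvmap₀ (sec₁ (fun w : ℂ => -w ^ 2) y₁.1.1)
            (sec₁ (fun w : ℂ => -w ^ 2) δ.1.1) (sec₁ (1 : ℂ → ℂ) δ.2.1)) w 1 +
          𝒥.swap.J₀ (𝒥.swap.vmap₀ (sec₁ (fun w : ℂ => -w ^ 2) y₁.1.1) (sec₁ (1 : ℂ → ℂ) y₁.2.1) w)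
            (fderiv ℝ (𝒥.swap.dvmap₀ (sec₁ (fun w : ℂ => -w ^ 2) y₁.1.1)
              (sec₁ (fun w : ℂ => -w ^ 2) δ.1.1) (sec₁ (1 : ℂ → ℂ) δ.2.1)) w I) +
          (fderiv ℝ 𝒥.swap.J₀
              (𝒥.swap.vmap₀ (sec₁ (fun w : ℂ => -w ^ 2) y₁.1.1) (sec₁ (1 : ℂ → ℂ) y₁.2.1) w)
              (𝒥.swap.dvmap₀ (sec₁ (fun w : ℂ => -w ^ 2) y₁.1.1)
                (sec₁ (fun w : ℂ => -w ^ 2) δ.1.1) (sec₁ (1 : ℂ → ℂ) δ.2.1) w))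
            (fderiv ℝ (𝒥.swap.vmap₀ (sec₁ (fun w : ℂ => -w ^ 2) y₁.1.1)
              (sec₁ (1 : ℂ → ℂ) y₁.2.1)) w I)) := by
  by_cases hw : ‖w‖ < 3
  · exact 𝒥.dout₁_apply_of_sol hk hy hsol₁ δ hw
  · rw [dout₁_apply, rhoCut_eq_zero (not_lt.1 hw), zero_smul, zero_smul]

end Banach

end SphereACData

end SphereCR

end Literature.Geometry.Symplectic

end
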